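/-
Copyright (c) 2026 the pub-hodgecm-mathlib formalisation cell (harness21).  Prover seat hodgecm-mathlib-LH4-p11 (g3), req620 Track A «(D-RAM) FOUR-FRAME» squad
(dealer LH4-plan (g11) WORD #56 (b): (κ-B₂) payer «TYPE 2, UNSIGNED»; generic arithmetic piece «κ-BOX-SUM₂», the tv-2 twin of LH4-p14 (g3)'s «κ-BOX-SUM»).  2026-09-04.
-/
import Summits.HodgeConjecture.HodgeConjecture.Theorems.F0P3cDyRamKappaCountBoxSumTwoPlane    -- FILE 2∕3 (this seat): `plane_eval`, `diag_eval`; brings FILE 1∕3 and ★ `StableCountBoxReindex`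
import HarnessLib

/-!
# Crux `H413`, (D-RAM) FOUR-FRAME, U3 §K-R — «κ-BOX-SUM₂» FILE 3∕3 (HEAD): THE TYPE-2 κ-TABLE SUMMED OVER THE AXIS BOX IS `SIGN·(q^k − q^(k − B₂))∕(q − 1)`

Cell `hodgecm-mathlib` (D-0151), FLOOR 0, crux item H413 = `stmt-HodgeConjecture-24833`, route of record `HCCMUnconditional`; lane `--supports stmt-HodgeConjecture-24833 --as helper`
(count-neutral).  THEOREMS ONLY (no `def`, no instance, no notation, no `sorry`).  Pure finite-sum arithmetic over `ℚ` — no lattices, no fields.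

THE ROAD («κ-BOX-SUM₂», three files).  The (κ-B₂) child `F0P3cDyRamFourFrameU3.stub_U3_kappaCount_typeTwo_mult` of tree U3 ED. 10 (:498) asks for
`|Σᶠ_{M ∈ 𝓛₀(T), type-2-polarisable} κ_i(M)·w(M)| = ampl q k (B + τ d)∕4`.  After ★ `F0P3cDyRamStrataDecompositionGeneric` (LH4-p10 (g3)) the left side is a sum over the axis
box `a : Fin 3 → Fin (Bx+1)` of per-stratum sums `v a`, and these are the TYPE-2 κ-SOCKETS (on-branch ★ `F0P3cDyRamDiagonalKappaSplitCountTwoSockets`; glued: LH4-p09 (g3)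
LETTER κB-G₂ v1 §4, typists F0P3-p01 (g31) ∕ LH4-p13 (g3); core-hanging: LH4-p06 (g3) LETTER κB-H₂ v1 §4, typists LH4-p07 (g5) ∕ LH4-p08 (g3)).  «κ-BOX-SUM₂» is the
ARITHMETIC of that box sum with the socket right-hand sides as hypotheses and the K-dependent signs replaced by rational PARAMETERS (`ω` on the on-branch ∕ tube cells,
`εG p j` on the glue cells of foot `p`, `εH` on the equilateral core-hanging cells) — LH4-p14 (g3)'s frozen type-0 grammar (`sum_box_kappa_eq_typeZero`) with the type-2 tables:
`(q − 1)·Σ_{a ∈ box} v a = SIGN·(q^k − q^(k − B₂))`, `B₂ = (n_i + 4 − 2(d%2) − 3d)∕2 = B + tauOfRecord d`.  VALIDATED before typing by literal transcription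
(`F0/P3c/LH4/LH4-p11/g3/kappa_boxsum_tv2_leanshape.v1.LH4p11g3.py` 997cfe04add05bbb: 2025 rows, 0 bad).

THIS FILE (3∕3): the HEAD `sum_box_kappa_eq_typeTwo` — binder order = LH4-p14 (g3)'s `sum_box_kappa_eq_typeZero` minus `hcore` (no type-2 core cell); tables: `hT1–3`
(`[i = p]·[2d ≤ s+1]·[s odd ≤ n_p]·ω·q^{⌊s∕2⌋}`), `hG1–3` (`ρ ≥ 0`: slot-`p` tube `ω·q^{2ρ+s∕2}((q−1)[2d ≤ s] − [s+2 = 2d])` + glue shell with brackets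
`[2d ≤ s + 2c]` (own) ∕ `[d ≤ c]` (cross), `c = (2ρ+1−m+1)∕2`, mass `q^{2ρ+s∕2+1−c}`), `hH` (glue only: `[d ≤ c]·εH·q^{2ρ+1−c}`), `hzero` = the ★ B3₂-γ shape list.
PROOF: ★ `sum_box_eq_triple_sum` + ★ `triple_sum_eq_diag_add_planes`, FILE 2's `diag_eval` + three `plane_eval`, then the key-shape case analysis with FILE 1's exponent identities.
* `sum_box_kappa_eq_typeTwo` — HEAD («κ-BOX-SUM₂»).
HONEST LABEL.  Count-neutral; nothing printed is asserted; (KMS) and its children stay PROVER TARGETS (empirical census laws in diagonal-model currency) until their payers land;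
`HC_CM` is proved only modulo the 7 printed citations (2 remaining named inputs: hLiu418 = `stmt-HodgeConjecture-24832`, h413 = `stmt-HodgeConjecture-24833`) until rung 0 closes.

## References
* [Rogawski1990] J. D. Rogawski, *Automorphic Representations of Unitary Groups in Three Variables*, Ann. of Math. Stud. 123 (1990), §4.9 Prop. 4.9.1 (b) p. 55 (the κ-count).
* [Kottwitz1986BaseChangeUnits] R. E. Kottwitz, *Base change for unit elements of Hecke algebras*, Compositio Math. 60 (1986), §1 pp. 240–241.
-/

set_option autoImplicit false

namespace Summit.HodgeConjecture.HodgeConjecture.Cruxes.H413.F0P3cDyRamKappaCountBoxSumTwo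

open Finset
open Summit.HodgeConjecture.HodgeConjecture.Cruxes.H413.F0P3cDyRamStableCountBoxReindex (vec3_eq_iff sum_box_eq_triple_sum triple_sum_eq_diag_add_planes)
open Summit.HodgeConjecture.HodgeConjecture.Cruxes.H413.F0P3cDyRamKappaCountBoxSumTwoBlocks
open Summit.HodgeConjecture.HodgeConjecture.Cruxes.H413.F0P3cDyRamKappaCountBoxSumTwoPlane

/-- **«κ-BOX-SUM₂» — THE TYPE-2 κ-TABLE SUMMED OVER THE AXIS BOX.**  LH4-p14 (g3)'s frozen type-0 grammar (`sum_box_kappa_eq_typeZero`) with the type-2 tables: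
isosceles key `(n₁,n₂,n₃)` of parity `d` (`2 ≤ d ≤ min`), shift `2k + d = n₁+n₂+n₃+2`, slot `i`, sign PARAMETERS `ω` (on-branch∕tube), `εG p j` (glue cells of foot `p`),
`εH` (equilateral core-hanging cells) with the conductor side conditions `hω_p` (apex slot with excess `≥ 2d` ⇒ `εG p p = ω`); a weight `v` on axis vectors following the
type-2 κ-socket right-hand sides (`hT1–3` = ★ `F0P3cDyRamDiagonalKappaSplitCountTwoSockets`; `hG1–3` = LH4-p09 (g3) LETTER κB-G₂ v1 §4, `ρ ≥ 0`; `hH` = LH4-p06 (g3) LETTER κB-H₂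
v1 §4) and vanishing off the ★ B3₂-γ shape list (`hzero`).  THEN `(q − 1)·Σ_{a ∈ box} v a = SIGN·(q^k − q^(k − (n_i + 4 − 2(d%2) − 3d)∕2))`, `SIGN = εH` (equilateral) ∕
`εG ‹apex› i`.  (The exponent deficit is `B + tauOfRecord d` of the (κ-B₂) child; `B ≤ 0`-type keys give `q^k − q^k = 0`.)
[cite: Rogawski1990, §4.9 Prop. 4.9.1 (b) p. 55] [cite: Kottwitz1986BaseChangeUnits, §1 pp. 240–241] -/
theorem sum_box_kappa_eq_typeTwo (q : ℕ) {d n₁ n₂ n₃ Bx k : ℕ} (hd : 2 ≤ d)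
    (hiso : (n₁ = n₂ ∧ n₁ ≤ n₃) ∨ (n₁ = n₃ ∧ n₁ ≤ n₂) ∨ (n₂ = n₃ ∧ n₂ ≤ n₁))
    (hdn : d ≤ min n₁ (min n₂ n₃)) (h1 : n₁ % 2 = d % 2) (h2 : n₂ % 2 = d % 2) (h3 : n₃ % 2 = d % 2) (hBx : n₁ + n₂ + n₃ ≤ Bx)
    (hk : 2 * k + d = n₁ + n₂ + n₃ + 2) (i : Fin 3) (ω εH : ℚ) (εG : Fin 3 → Fin 3 → ℚ)
    (hω0 : i = 0 → n₂ = n₃ → n₂ + 2 * d ≤ n₁ → εG 0 0 = ω) (hω1 : i = 1 → n₁ = n₃ → n₁ + 2 * d ≤ n₂ → εG 1 1 = ω)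
    (hω2 : i = 2 → n₁ = n₂ → n₁ + 2 * d ≤ n₃ → εG 2 2 = ω)
    (v : (Fin 3 → ℕ) → ℚ)
    (hT1 : ∀ s, 1 ≤ s → v ![0, s, s] = if i = 0 ∧ 2 * d ≤ s + 1 ∧ ¬ 2 ∣ s ∧ s ≤ n₁ then ω * (q : ℚ) ^ (s / 2) else 0)
    (hT2 : ∀ s, 1 ≤ s → v ![s, 0, s] = if i = 1 ∧ 2 * d ≤ s + 1 ∧ ¬ 2 ∣ s ∧ s ≤ n₂ then ω * (q : ℚ) ^ (s / 2) else 0)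
    (hT3 : ∀ s, 1 ≤ s → v ![s, s, 0] = if i = 2 ∧ 2 * d ≤ s + 1 ∧ ¬ 2 ∣ s ∧ s ≤ n₃ then ω * (q : ℚ) ^ (s / 2) else 0)
    (hG1 : ∀ ρ s, 1 ≤ s → v ![2 * ρ + 1, 2 * ρ + 1 + s, 2 * ρ + 1 + s] =
      (if 2 ∣ s ∧ 2 * ρ + 1 ≤ min n₂ n₃ ∧ 2 * ρ + 1 + s ≤ n₁ then
          (![ω * (q : ℚ) ^ (2 * ρ + s / 2) * ((if 2 * d ≤ s then (q : ℚ) - 1 else 0) - (if s + 2 = 2 * d then 1 else 0)), 0, 0] : Fin 3 → ℚ) i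
        else 0) +
      (if 2 ∣ s ∧ n₂ = n₃ ∧ n₁ = n₂ + s ∧ n₂ < 2 * ρ + 1 ∧ 2 * ρ + 1 ≤ 2 * n₂ ∧ 2 * ρ + 1 - n₂ ≤ n₂ - d + 1 then
          (![if 2 * d ≤ s + 2 * ((2 * ρ + 1 - n₂ + 1) / 2) then εG 0 0 else 0,
             if d ≤ (2 * ρ + 1 - n₂ + 1) / 2 then εG 0 1 else 0,
             if d ≤ (2 * ρ + 1 - n₂ + 1) / 2 then εG 0 2 else 0] : Fin 3 → ℚ) i * (q : ℚ) ^ (2 * ρ + s / 2 + 1 - (2 * ρ + 1 - n₂ + 1) / 2)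
        else 0))
    (hG2 : ∀ ρ s, 1 ≤ s → v ![2 * ρ + 1 + s, 2 * ρ + 1, 2 * ρ + 1 + s] =
      (if 2 ∣ s ∧ 2 * ρ + 1 ≤ min n₁ n₃ ∧ 2 * ρ + 1 + s ≤ n₂ then
          (![0, ω * (q : ℚ) ^ (2 * ρ + s / 2) * ((if 2 * d ≤ s then (q : ℚ) - 1 else 0) - (if s + 2 = 2 * d then 1 else 0)), 0] : Fin 3 → ℚ) i
        else 0) +
      (if 2 ∣ s ∧ n₁ = n₃ ∧ n₂ = n₁ + s ∧ n₁ < 2 * ρ + 1 ∧ 2 * ρ + 1 ≤ 2 * n₁ ∧ 2 * ρ + 1 - n₁ ≤ n₁ - d + 1 then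
          (![if d ≤ (2 * ρ + 1 - n₁ + 1) / 2 then εG 1 0 else 0,
             if 2 * d ≤ s + 2 * ((2 * ρ + 1 - n₁ + 1) / 2) then εG 1 1 else 0,
             if d ≤ (2 * ρ + 1 - n₁ + 1) / 2 then εG 1 2 else 0] : Fin 3 → ℚ) i * (q : ℚ) ^ (2 * ρ + s / 2 + 1 - (2 * ρ + 1 - n₁ + 1) / 2)
        else 0))
    (hG3 : ∀ ρ s, 1 ≤ s → v ![2 * ρ + 1 + s, 2 * ρ + 1 + s, 2 * ρ + 1] =
      (if 2 ∣ s ∧ 2 * ρ + 1 ≤ min n₁ n₂ ∧ 2 * ρ + 1 + s ≤ n₃ then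
          (![0, 0, ω * (q : ℚ) ^ (2 * ρ + s / 2) * ((if 2 * d ≤ s then (q : ℚ) - 1 else 0) - (if s + 2 = 2 * d then 1 else 0))] : Fin 3 → ℚ) i
        else 0) +
      (if 2 ∣ s ∧ n₁ = n₂ ∧ n₃ = n₁ + s ∧ n₁ < 2 * ρ + 1 ∧ 2 * ρ + 1 ≤ 2 * n₁ ∧ 2 * ρ + 1 - n₁ ≤ n₁ - d + 1 then
          (![if d ≤ (2 * ρ + 1 - n₁ + 1) / 2 then εG 2 0 else 0,
             if d ≤ (2 * ρ + 1 - n₁ + 1) / 2 then εG 2 1 else 0,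
             if 2 * d ≤ s + 2 * ((2 * ρ + 1 - n₁ + 1) / 2) then εG 2 2 else 0] : Fin 3 → ℚ) i * (q : ℚ) ^ (2 * ρ + s / 2 + 1 - (2 * ρ + 1 - n₁ + 1) / 2)
        else 0))
    (hH : ∀ ρ, v ![2 * ρ + 1, 2 * ρ + 1, 2 * ρ + 1] =
      if n₁ = n₂ ∧ n₂ = n₃ ∧ n₁ < 2 * ρ + 1 ∧ 2 * ρ + 1 ≤ 2 * n₁ ∧ 2 * ρ + 1 - n₁ ≤ n₁ - d + 1 ∧ d ≤ (2 * ρ + 1 - n₁ + 1) / 2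
      then εH * (q : ℚ) ^ (2 * ρ + 1 - (2 * ρ + 1 - n₁ + 1) / 2) else 0)
    (hzero : ∀ a : Fin 3 → ℕ, ¬ ((∃ s, ¬ 2 ∣ s ∧ (a = ![0, s, s] ∨ a = ![s, 0, s] ∨ a = ![s, s, 0])) ∨
      (∃ ρ s, 2 ∣ s ∧ 2 ≤ s ∧ (a = ![2 * ρ + 1, 2 * ρ + 1 + s, 2 * ρ + 1 + s] ∨ a = ![2 * ρ + 1 + s, 2 * ρ + 1, 2 * ρ + 1 + s] ∨
        a = ![2 * ρ + 1 + s, 2 * ρ + 1 + s, 2 * ρ + 1])) ∨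
      (∃ ρ, a = ![2 * ρ + 1, 2 * ρ + 1, 2 * ρ + 1])) → v a = 0) :
    ((q : ℚ) - 1) * ∑ a : Fin 3 → Fin (Bx + 1), v (fun j => (a j : ℕ)) =
      (if n₁ = n₂ ∧ n₂ = n₃ then εH else if n₂ = n₃ then εG 0 i else if n₁ = n₃ then εG 1 i else εG 2 i) *
        ((q : ℚ) ^ k - (q : ℚ) ^ (k - ((![n₁, n₂, n₃] : Fin 3 → ℕ) i + 4 - 2 * (d % 2) - 3 * d) / 2)) := by
  -- shape consequences of `hzero`
  have hz : ∀ a : Fin 3 → ℕ, v a ≠ 0 → ((∃ s, ¬ 2 ∣ s ∧ (a = ![0, s, s] ∨ a = ![s, 0, s] ∨ a = ![s, s, 0])) ∨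
      (∃ ρ s, 2 ∣ s ∧ 2 ≤ s ∧ (a = ![2 * ρ + 1, 2 * ρ + 1 + s, 2 * ρ + 1 + s] ∨ a = ![2 * ρ + 1 + s, 2 * ρ + 1, 2 * ρ + 1 + s] ∨
        a = ![2 * ρ + 1 + s, 2 * ρ + 1 + s, 2 * ρ + 1])) ∨
      (∃ ρ, a = ![2 * ρ + 1, 2 * ρ + 1, 2 * ρ + 1])) := fun a ha => not_imp_comm.1 (hzero a) ha
  have hreg : ∀ x y z : ℕ, v ![x, y, z] ≠ 0 → (x = y ∧ y = z) ∨ (y = z ∧ x < y) ∨ (x = z ∧ y < x) ∨ (x = y ∧ z < x) := by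
    intro x y z hne
    rcases hz _ hne with ⟨s, hs, h | h | h⟩ | ⟨ρ, s, -, hs, h | h | h⟩ | ⟨ρ, h⟩ <;> rw [vec3_eq_iff] at h <;> omega
  have hev : ∀ x y z : ℕ, 2 ∣ x → 2 ∣ y → 2 ∣ z → v ![x, y, z] = 0 := by
    intro x y z hx hy hz'
    by_contra hne
    rcases hz _ hne with ⟨s, hs, h | h | h⟩ | ⟨ρ, s, hs2, hs, h | h | h⟩ | ⟨ρ, h⟩ <;> rw [vec3_eq_iff] at h <;> omega
  have hodd1 : ∀ ρ s, 1 ≤ s → v ![2 * ρ + 2, 2 * ρ + 2 + s, 2 * ρ + 2 + s] = 0 := by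
    intro ρ s hs1
    by_contra hne
    rcases hz _ hne with ⟨s', hs', h | h | h⟩ | ⟨ρ', s', hs2, hs', h | h | h⟩ | ⟨ρ', h⟩ <;> rw [vec3_eq_iff] at h <;> omega
  have hodd2 : ∀ ρ s, 1 ≤ s → v ![2 * ρ + 2 + s, 2 * ρ + 2, 2 * ρ + 2 + s] = 0 := by
    intro ρ s hs1
    by_contra hne
    rcases hz _ hne with ⟨s', hs', h | h | h⟩ | ⟨ρ', s', hs2, hs', h | h | h⟩ | ⟨ρ', h⟩ <;> rw [vec3_eq_iff] at h <;> omega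
  have hodd3 : ∀ ρ s, 1 ≤ s → v ![2 * ρ + 2 + s, 2 * ρ + 2 + s, 2 * ρ + 2] = 0 := by
    intro ρ s hs1
    by_contra hne
    rcases hz _ hne with ⟨s', hs', h | h | h⟩ | ⟨ρ', s', hs2, hs', h | h | h⟩ | ⟨ρ', h⟩ <;> rw [vec3_eq_iff] at h <;> omega
  have hm₁ : min n₁ (min n₂ n₃) ≤ n₁ := min_le_left _ _
  have hm₂ : min n₁ (min n₂ n₃) ≤ n₂ := le_trans (min_le_right _ _) (min_le_left _ _)
  have hm₃ : min n₁ (min n₂ n₃) ≤ n₃ := le_trans (min_le_right _ _) (min_le_right _ _)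
  -- the four pieces
  have hD := diag_eval (q : ℚ) (B := Bx) hd (le_trans hdn hm₁) h1 hBx εH (fun r => v ![r, r, r])
    (hev 0 0 0 (dvd_zero 2) (dvd_zero 2) (dvd_zero 2)) hH (fun ρ => hev _ _ _ ⟨ρ + 1, by ring⟩ ⟨ρ + 1, by ring⟩ ⟨ρ + 1, by ring⟩)
  have hP1 := plane_eval (q : ℚ) (B := Bx) (n := n₁) (μ' := n₂) (μ'' := n₃) hd (le_min (le_trans hdn hm₂) (le_trans hdn hm₃)) h1 h2 h3 hBx
    ω (εG 0 i) (i = 0) (fun r t => v ![r, t, t]) hT1 (fun ρ s hs => by rw [hG1 ρ s hs, vecT0, vecG0]) hodd1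
  have hP2 := plane_eval (q : ℚ) (B := Bx) (n := n₂) (μ' := n₁) (μ'' := n₃) hd (le_min (le_trans hdn hm₁) (le_trans hdn hm₃)) h2 h1 h3 (by omega)
    ω (εG 1 i) (i = 1) (fun r t => v ![t, r, t]) hT2 (fun ρ s hs => by rw [hG2 ρ s hs, vecT1, vecG1]) hodd2
  have hP3 := plane_eval (q : ℚ) (B := Bx) (n := n₃) (μ' := n₁) (μ'' := n₂) hd (le_min (le_trans hdn hm₁) (le_trans hdn hm₂)) h3 h1 h2 (by omega)
    ω (εG 2 i) (i = 2) (fun r t => v ![t, t, r]) hT3 (fun ρ s hs => by rw [hG3 ρ s hs, vecT2, vecG2]) hodd3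
  rw [sum_box_eq_triple_sum, triple_sum_eq_diag_add_planes Bx v hreg, mul_add, mul_add, mul_add, hD, hP1, hP2, hP3]
  have hi : i = 0 ∨ i = 1 ∨ i = 2 := by fin_cases i <;> simp
  have c01 : ¬ ((0 : Fin 3) = 1) := by decide
  have c02 : ¬ ((0 : Fin 3) = 2) := by decide
  have c10 : ¬ ((1 : Fin 3) = 0) := by decide
  have c12 : ¬ ((1 : Fin 3) = 2) := by decide
  have c20 : ¬ ((2 : Fin 3) = 0) := by decide
  have c21 : ¬ ((2 : Fin 3) = 1) := by decide
  -- CASE ANALYSIS ON THE KEY SHAPE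
  rcases hiso with ⟨h12, h13⟩ | ⟨h13, h12⟩ | ⟨h23, h21⟩
  · rcases Nat.lt_or_ge n₁ n₃ with hlt | hge
    · -- apex = foot 2
      have hE : ¬ (n₁ = n₂ ∧ n₂ = n₃) := fun h => absurd h.2 (by omega)
      have hGt : n₁ = n₂ ∧ n₁ < n₃ := ⟨h12, hlt⟩
      have hGf1 : ¬ (n₂ = n₃ ∧ n₂ < n₁) := fun h => absurd h.2 (by omega)
      have hGf2 : ¬ (n₁ = n₃ ∧ n₁ < n₂) := fun h => absurd h.2 (by omega)
      have hTf1 : ¬ (min n₂ n₃ + 2 * d ≤ n₁) := by rw [min_eq_left (by omega : n₂ ≤ n₃)]; omega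
      have hTf2 : ¬ (min n₁ n₃ + 2 * d ≤ n₂) := by rw [min_eq_left (by omega : n₁ ≤ n₃)]; omega
      have hk' : 2 * k + d = 2 * n₁ + n₃ + 2 := by omega
      simp only [if_neg hE, if_pos hGt, if_neg hGf1, if_neg hGf2, if_neg hTf1, if_neg hTf2, if_neg (show ¬ (n₂ = n₃) by omega), if_neg (show ¬ (n₁ = n₃) by omega), mul_zero, ite_self, add_zero, zero_add]
      rw [min_eq_left (le_of_eq h12)]
      rcases hi with rfl | rfl | rfl
      · simp only [if_neg c02, vec3_0, zero_add]
        rw [exp_K h1 h3 (le_trans hdn hm₁) hlt.le hk', exp_cross hd h1 h3 (le_trans hdn hm₁) hk']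
      · simp only [if_neg c12, vec3_1, zero_add]
        rw [← h12, exp_K h1 h3 (le_trans hdn hm₁) hlt.le hk', exp_cross hd h1 h3 (le_trans hdn hm₁) hk']
      · simp only [if_true, vec3_2]
        by_cases hal : n₁ + 2 * d ≤ n₃
        · rw [if_pos hal, hω2 rfl h12 hal, exp_K h1 h3 (le_trans hdn hm₁) hlt.le hk', max_own_alive hal, exp_own_top hd h1 h3 (le_trans hdn hm₁) hk',
            exp_own_bot hd h1 h3 (le_trans hdn hm₁) hal hk']
          ring
        · rw [if_neg hal, mul_zero, zero_add, exp_K h1 h3 (le_trans hdn hm₁) hlt.le hk', max_own_dead h1 h3 hlt hal, exp_own_dead h1 h3 (le_trans hdn hm₁) hlt hal hk']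
    · -- equilateral key
      have hE : n₁ = n₂ ∧ n₂ = n₃ := ⟨h12, by omega⟩
      have hG1c : ¬ (n₂ = n₃ ∧ n₂ < n₁) := fun h => absurd h.2 (by omega)
      have hG2c : ¬ (n₁ = n₃ ∧ n₁ < n₂) := fun h => absurd h.2 (by omega)
      have hG3c : ¬ (n₁ = n₂ ∧ n₁ < n₃) := fun h => absurd h.2 (by omega)
      have hT1c : ¬ (min n₂ n₃ + 2 * d ≤ n₁) := by rw [min_eq_left (le_of_eq hE.2)]; omega
      have hT2c : ¬ (min n₁ n₃ + 2 * d ≤ n₂) := by rw [min_eq_left (le_of_eq (hE.1.trans hE.2))]; omega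
      have hT3c : ¬ (min n₁ n₂ + 2 * d ≤ n₃) := by rw [min_eq_left (le_of_eq hE.1)]; omega
      have hvi : (![n₁, n₂, n₃] : Fin 3 → ℕ) i = n₁ := by
        rcases hi with rfl | rfl | rfl
        · rfl
        · exact hE.1.symm
        · exact (hE.1.trans hE.2).symm
      simp only [if_pos hE, if_neg hG1c, if_neg hG2c, if_neg hG3c, if_neg hT1c, if_neg hT2c, if_neg hT3c, mul_zero, ite_self, add_zero, hvi]
      have hk' : 2 * k + d = 2 * n₁ + n₁ + 2 := by omega
      rw [exp_KD h1 (le_trans hdn hm₁) hk', exp_cross hd h1 h1 (le_trans hdn hm₁) hk']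
  · rcases Nat.lt_or_ge n₁ n₂ with hlt | hge
    · -- apex = foot 1
      have hE : ¬ (n₁ = n₂ ∧ n₂ = n₃) := fun h => absurd h.1 (by omega)
      have hGt : n₁ = n₃ ∧ n₁ < n₂ := ⟨h13, hlt⟩
      have hGf1 : ¬ (n₂ = n₃ ∧ n₂ < n₁) := fun h => absurd h.2 (by omega)
      have hGf2 : ¬ (n₁ = n₂ ∧ n₁ < n₃) := fun h => absurd h.2 (by omega)
      have hTf1 : ¬ (min n₂ n₃ + 2 * d ≤ n₁) := by rw [min_eq_right (by omega : n₃ ≤ n₂)]; omega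
      have hTf2 : ¬ (min n₁ n₂ + 2 * d ≤ n₃) := by rw [min_eq_left (by omega : n₁ ≤ n₂)]; omega
      have hk' : 2 * k + d = 2 * n₁ + n₂ + 2 := by omega
      simp only [if_neg hE, if_pos hGt, if_neg hGf1, if_neg hGf2, if_neg hTf1, if_neg hTf2, if_neg (show ¬ (n₂ = n₃) by omega), if_pos h13, mul_zero, ite_self, add_zero, zero_add]
      rw [min_eq_left (le_of_eq h13)]
      rcases hi with rfl | rfl | rfl
      · simp only [if_neg c01, vec3_0, zero_add]
        rw [exp_K h1 h2 (le_trans hdn hm₁) hlt.le hk', exp_cross hd h1 h2 (le_trans hdn hm₁) hk']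
      · simp only [if_true, vec3_1]
        by_cases hal : n₁ + 2 * d ≤ n₂
        · rw [if_pos hal, hω1 rfl h13 hal, exp_K h1 h2 (le_trans hdn hm₁) hlt.le hk', max_own_alive hal, exp_own_top hd h1 h2 (le_trans hdn hm₁) hk',
            exp_own_bot hd h1 h2 (le_trans hdn hm₁) hal hk']
          ring
        · rw [if_neg hal, mul_zero, zero_add, exp_K h1 h2 (le_trans hdn hm₁) hlt.le hk', max_own_dead h1 h2 hlt hal, exp_own_dead h1 h2 (le_trans hdn hm₁) hlt hal hk']
      · simp only [if_neg c21, vec3_2, zero_add]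
        rw [← h13, exp_K h1 h2 (le_trans hdn hm₁) hlt.le hk', exp_cross hd h1 h2 (le_trans hdn hm₁) hk']
    · -- equilateral key
      have hE : n₁ = n₂ ∧ n₂ = n₃ := ⟨by omega, by omega⟩
      have hG1c : ¬ (n₂ = n₃ ∧ n₂ < n₁) := fun h => absurd h.2 (by omega)
      have hG2c : ¬ (n₁ = n₃ ∧ n₁ < n₂) := fun h => absurd h.2 (by omega)
      have hG3c : ¬ (n₁ = n₂ ∧ n₁ < n₃) := fun h => absurd h.2 (by omega)
      have hT1c : ¬ (min n₂ n₃ + 2 * d ≤ n₁) := by rw [min_eq_left (le_of_eq hE.2)]; omega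
      have hT2c : ¬ (min n₁ n₃ + 2 * d ≤ n₂) := by rw [min_eq_left (le_of_eq (hE.1.trans hE.2))]; omega
      have hT3c : ¬ (min n₁ n₂ + 2 * d ≤ n₃) := by rw [min_eq_left (le_of_eq hE.1)]; omega
      have hvi : (![n₁, n₂, n₃] : Fin 3 → ℕ) i = n₁ := by
        rcases hi with rfl | rfl | rfl
        · rfl
        · exact hE.1.symm
        · exact (hE.1.trans hE.2).symm
      simp only [if_pos hE, if_neg hG1c, if_neg hG2c, if_neg hG3c, if_neg hT1c, if_neg hT2c, if_neg hT3c, mul_zero, ite_self, add_zero, hvi]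
      have hk' : 2 * k + d = 2 * n₁ + n₁ + 2 := by omega
      rw [exp_KD h1 (le_trans hdn hm₁) hk', exp_cross hd h1 h1 (le_trans hdn hm₁) hk']
  · rcases Nat.lt_or_ge n₂ n₁ with hlt | hge
    · -- apex = foot 0
      have hE : ¬ (n₁ = n₂ ∧ n₂ = n₃) := fun h => absurd (h.1.trans h.2) (by omega)
      have hGt : n₂ = n₃ ∧ n₂ < n₁ := ⟨h23, hlt⟩
      have hGf1 : ¬ (n₁ = n₃ ∧ n₁ < n₂) := fun h => absurd h.2 (by omega)
      have hGf2 : ¬ (n₁ = n₂ ∧ n₁ < n₃) := fun h => absurd h.2 (by omega)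
      have hTf1 : ¬ (min n₁ n₃ + 2 * d ≤ n₂) := by rw [min_eq_right (by omega : n₃ ≤ n₁)]; omega
      have hTf2 : ¬ (min n₁ n₂ + 2 * d ≤ n₃) := by rw [min_eq_right (by omega : n₂ ≤ n₁)]; omega
      have hk' : 2 * k + d = 2 * n₂ + n₁ + 2 := by omega
      simp only [if_neg hE, if_pos hGt, if_neg hGf1, if_neg hGf2, if_neg hTf1, if_neg hTf2, if_pos h23, mul_zero, ite_self, add_zero, zero_add]
      rw [min_eq_left (le_of_eq h23)]
      rcases hi with rfl | rfl | rfl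
      · simp only [if_true, vec3_0]
        by_cases hal : n₂ + 2 * d ≤ n₁
        · rw [if_pos hal, hω0 rfl h23 hal, exp_K h2 h1 (le_trans hdn hm₂) hlt.le hk', max_own_alive hal, exp_own_top hd h2 h1 (le_trans hdn hm₂) hk',
            exp_own_bot hd h2 h1 (le_trans hdn hm₂) hal hk']
          ring
        · rw [if_neg hal, mul_zero, zero_add, exp_K h2 h1 (le_trans hdn hm₂) hlt.le hk', max_own_dead h2 h1 hlt hal, exp_own_dead h2 h1 (le_trans hdn hm₂) hlt hal hk']
      · simp only [if_neg c10, vec3_1, zero_add]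
        rw [exp_K h2 h1 (le_trans hdn hm₂) hlt.le hk', exp_cross hd h2 h1 (le_trans hdn hm₂) hk']
      · simp only [if_neg c20, vec3_2, zero_add]
        rw [← h23, exp_K h2 h1 (le_trans hdn hm₂) hlt.le hk', exp_cross hd h2 h1 (le_trans hdn hm₂) hk']
    · -- equilateral key
      have hE : n₁ = n₂ ∧ n₂ = n₃ := ⟨by omega, h23⟩
      have hG1c : ¬ (n₂ = n₃ ∧ n₂ < n₁) := fun h => absurd h.2 (by omega)
      have hG2c : ¬ (n₁ = n₃ ∧ n₁ < n₂) := fun h => absurd h.2 (by omega)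
      have hG3c : ¬ (n₁ = n₂ ∧ n₁ < n₃) := fun h => absurd h.2 (by omega)
      have hT1c : ¬ (min n₂ n₃ + 2 * d ≤ n₁) := by rw [min_eq_left (le_of_eq hE.2)]; omega
      have hT2c : ¬ (min n₁ n₃ + 2 * d ≤ n₂) := by rw [min_eq_left (le_of_eq (hE.1.trans hE.2))]; omega
      have hT3c : ¬ (min n₁ n₂ + 2 * d ≤ n₃) := by rw [min_eq_left (le_of_eq hE.1)]; omega
      have hvi : (![n₁, n₂, n₃] : Fin 3 → ℕ) i = n₁ := by
        rcases hi with rfl | rfl | rfl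
        · rfl
        · exact hE.1.symm
        · exact (hE.1.trans hE.2).symm
      simp only [if_pos hE, if_neg hG1c, if_neg hG2c, if_neg hG3c, if_neg hT1c, if_neg hT2c, if_neg hT3c, mul_zero, ite_self, add_zero, hvi]
      have hk' : 2 * k + d = 2 * n₁ + n₁ + 2 := by omega
      rw [exp_KD h1 (le_trans hdn hm₁) hk', exp_cross hd h1 h1 (le_trans hdn hm₁) hk']

end Summit.HodgeConjecture.HodgeConjecture.Cruxes.H413.F0P3cDyRamKappaCountBoxSumTwo
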